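/-
Origin: expansion seat `planner-pub-hodgecm-toy2-g8-0`, handover #1 2026-08-18T15:11:03Z (`HOME/pub-hodgecm-toy2-g8/lean/Toy2g8/SubHS.lean`, md5 532e292c, 293 lines);
landed by the gen-8 packager in gate run 31 as `HodgeCM/Model/Toy/SubHS.lean` (verbatim).
-/
/-
Origin: CONSISTENCY seat 2 gen 8 `planner-pub-hodgecm-toy2-g8-0` (unit `pub-hodgecm-toy2-g8`), WIP
`HOME/pub-hodgecm-toy2-g8/lean/Toy2g8/SubHS.lean`; intended target `HodgeCM/Model/Toy/SubHS.lean` (new leaf).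
-/
import Mathlib
import Summits.HodgeConjecture.HodgeCM.Model.Toy.LefTypes
import Summits.HodgeConjecture.HodgeCM.Model.Toy.Primitive

/-!
# Rational sub-Hodge structures of the toy objects (functional form)

For a gen-1 toy object `X` (`HodgeCM.Toy.Obj`: lattice `L X = Π_i F_i`, eigenbasis `e_s` of `ℂ ⊗ L X` indexed by
`s = (i, τ)`, Galois types `typ s ⊆ Aut_ℚ(ℚ̄)`), the **type-diagonal operators** `D_U = Σ_s U(typ s) · E_s`
(`U : Set Gam → ℂ`; `E_s` the coordinate projector of `e_s`) commute with every Hodge map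
(`typOp_baseChange_comm`, from the link lemma `typ_eq_of_coefQ_ne_zero` of `HodgeCM.Model.Toy.LefTypes`).

A rational subspace `N ≤ L X` is a **sub-Hodge structure** (`Obj.IsSubHS`) when every `D_U` maps `1 ⊗ N` into the
complex span of `N`, stated dually: every rational functional vanishing on `N` kills `D_U (1 ⊗ n)`, `n ∈ N`.
Closure properties: `⊤`, `⊥`, images and kernels of Hodge maps, `⊓`, `⊔`, finite `⨆`
(`isSubHS_top/bot`, `IsSubHS.map`, `isSubHS_ker`, `IsSubHS.inf/sup`, `isSubHS_biSup`).

**Rigidity** (`IsSubHS.eq_bot_or_eq_top`): if the Galois types of the one-atom CM object `A_{(K,Φ)}` are pairwise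
distinct, its only sub-Hodge structures are `⊥` and `⊤`; and the types ARE pairwise distinct for a primitive CM type
of a Galois CM field (`typ_injective_of_primitive`, e.g. every CM type of `ℚ(ζ₁₇)` by `cyclo17_primitive`).

Used by `HodgeCM.Model.Toy.HsMod` (the sub-Hodge-structure modifier: the F4 row of the load-bearing census of
`COR_CM_of_descentFactsB₄` with `RealisationExistsFace`).  All proofs kernel-checked; nothing is cited.
-/

noncomputable section

/- as in `HodgeCM.Model.Toy.LefTypes` / `.Primitive`: instances on `ℚ̄ ⊆ ℂ` are only found with the pre-4.32
transparency behaviour of unification -/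
set_option backward.isDefEq.respectTransparency false

namespace HodgeCM.Toy

open Literature.AlgebraicGeometry.Motives
open scoped TensorProduct
open Module CMPresentation

namespace Obj

variable (X : Obj) {Y Z : Obj}

/-! ### Type-diagonal operators -/

/-- the type-diagonal operator `D_U = Σ_s U(typ s) E_s` on `ℂ ⊗ L X` -/
def typOp (U : Set Gam → ℂ) : X.LC →ₗ[ℂ] X.LC :=
  X.eB.constr ℂ fun s => U (X.typ s) • X.eB s

/-- (Ported verbatim from the HodgeCMPerL package; no docstring in the source.) -/
lemma typOp_eB (U : Set Gam → ℂ) (s : X.Idx) : X.typOp U (X.eB s) = U (X.typ s) • X.eB s :=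
  Basis.constr_basis _ _ _ _

/-- coordinates: `(D_U x)_s = U(typ s) · x_s` -/
theorem repr_typOp (U : Set Gam → ℂ) (x : X.LC) (s : X.Idx) :
    X.eB.repr (X.typOp U x) s = U (X.typ s) * X.eB.repr x s := by
  have key : (X.eB.coord s) ∘ₗ X.typOp U = U (X.typ s) • X.eB.coord s := by
    refine X.eB.ext fun t => ?_
    simp only [LinearMap.comp_apply, typOp_eB, map_smul, LinearMap.smul_apply, Basis.coord_apply,
      Basis.repr_self, smul_eq_mul, Finsupp.single_apply]
    by_cases h : t = s
    · subst h; simp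
    · rw [if_neg h, mul_zero, mul_zero]
  have := LinearMap.congr_fun key x
  simpa only [LinearMap.comp_apply, Basis.coord_apply, LinearMap.smul_apply, smul_eq_mul] using this

/-- **type-diagonal operators commute with Hodge maps** (link lemma) -/
theorem typOp_baseChange_comm (f : Hom X Y) (U : Set Gam → ℂ) :
    X.typOp U ∘ₗ f.lin.baseChange ℂ = f.lin.baseChange ℂ ∘ₗ Y.typOp U := by
  refine Y.eB.ext fun t => ?_
  rw [LinearMap.comp_apply, LinearMap.comp_apply, typOp_eB, map_smul]
  refine X.eB.repr.injective (Finsupp.ext fun s => ?_)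
  rw [repr_typOp, map_smul, Finsupp.smul_apply, smul_eq_mul, repr_baseChange_eB]
  by_cases h : coefQ f.lin s t = 0
  · rw [h]; simp
  · rw [typ_eq_of_coefQ_ne_zero f h]

/-- (Ported verbatim from the HodgeCMPerL package; no docstring in the source.) -/
theorem typOp_baseChange_apply (f : Hom X Y) (U : Set Gam → ℂ) (y : Y.LC) :
    X.typOp U (f.lin.baseChange ℂ y) = f.lin.baseChange ℂ (Y.typOp U y) := by
  have := LinearMap.congr_fun (X.typOp_baseChange_comm f U) y
  simpa only [LinearMap.comp_apply] using this

/-! ### Complexified rational functionals -/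

/-- the complexification `λ_ℂ : ℂ ⊗ L X → ℂ`, `c ⊗ ℓ ↦ λ(ℓ) · c`, of a rational functional `λ` -/
def lamC (lam : X.L →ₗ[ℚ] ℚ) : X.LC →ₗ[ℂ] ℂ :=
  (TensorProduct.AlgebraTensorModule.rid ℚ ℂ ℂ).toLinearMap ∘ₗ lam.baseChange ℂ

/-- (Ported verbatim from the HodgeCMPerL package; no docstring in the source.) -/
@[simp] lemma lamC_tmul (lam : X.L →ₗ[ℚ] ℚ) (c : ℂ) (ℓ : X.L) : X.lamC lam (c ⊗ₜ ℓ) = lam ℓ • c := by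
  simp [lamC, LinearMap.baseChange_tmul, TensorProduct.AlgebraTensorModule.rid_tmul]

/-- (Ported verbatim from the HodgeCMPerL package; no docstring in the source.) -/
lemma lamC_add (lam mu : X.L →ₗ[ℚ] ℚ) : X.lamC (lam + mu) = X.lamC lam + X.lamC mu := by
  simp [lamC, LinearMap.baseChange_add, LinearMap.comp_add]

/-- (Ported verbatim from the HodgeCMPerL package; no docstring in the source.) -/
lemma lamC_zero : X.lamC 0 = 0 := by
  simp [lamC, LinearMap.baseChange_zero]

/-- `(λ ∘ f)_ℂ = λ_ℂ ∘ f_ℂ` -/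
lemma lamC_comp (f : Y.L →ₗ[ℚ] X.L) (lam : X.L →ₗ[ℚ] ℚ) :
    Y.lamC (lam ∘ₗ f) = X.lamC lam ∘ₗ f.baseChange ℂ := by
  rw [lamC, lamC, LinearMap.baseChange_comp, LinearMap.comp_assoc]

/-- (Ported verbatim from the HodgeCMPerL package; no docstring in the source.) -/
lemma lamC_comp_apply (f : Y.L →ₗ[ℚ] X.L) (lam : X.L →ₗ[ℚ] ℚ) (y : Y.LC) :
    Y.lamC (lam ∘ₗ f) y = X.lamC lam (f.baseChange ℂ y) := by
  rw [lamC_comp]; rfl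

/-- a rational functional with vanishing complexification on `1 ⊗ L` vanishes -/
lemma lam_eq_zero_of_lamC (lam : X.L →ₗ[ℚ] ℚ) (h : ∀ ℓ : X.L, X.lamC lam ((1 : ℂ) ⊗ₜ ℓ) = 0) : lam = 0 := by
  refine LinearMap.ext fun ℓ => ?_
  have := h ℓ
  rw [lamC_tmul, smul_eq_zero] at this
  simpa using this

/-! ### Sub-Hodge structures -/

/-- **`N ≤ L X` is a rational sub-Hodge structure**: every rational functional vanishing on `N` kills
`D_U (1 ⊗ n)` for all type-diagonal operators `D_U` and all `n ∈ N`. -/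
def IsSubHS (N : Submodule ℚ X.L) : Prop :=
  ∀ (U : Set Gam → ℂ) (n : X.L), n ∈ N → ∀ lam : X.L →ₗ[ℚ] ℚ, (∀ m ∈ N, lam m = 0) →
    X.lamC lam (X.typOp U ((1 : ℂ) ⊗ₜ n)) = 0

/-- (Ported verbatim from the HodgeCMPerL package; no docstring in the source.) -/
theorem isSubHS_top : X.IsSubHS ⊤ := by
  intro U n _ lam hlam
  have h0 : lam = 0 := LinearMap.ext fun m => hlam m Submodule.mem_top
  rw [h0, lamC_zero, LinearMap.zero_apply]

/-- (Ported verbatim from the HodgeCMPerL package; no docstring in the source.) -/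
theorem isSubHS_bot : X.IsSubHS ⊥ := by
  intro U n hn lam _
  rw [(Submodule.mem_bot ℚ).mp hn, TensorProduct.tmul_zero, map_zero, map_zero]

variable {X}

/-- **images**: the image of a sub-Hodge structure under a Hodge map is a sub-Hodge structure -/
theorem IsSubHS.map (f : Hom X Y) {N : Submodule ℚ Y.L} (hN : Y.IsSubHS N) : X.IsSubHS (N.map f.lin) := by
  intro U n hn lam hlam
  obtain ⟨n₀, hn₀, rfl⟩ := Submodule.mem_map.mp hn
  have h1 : ((1 : ℂ) ⊗ₜ[ℚ] f.lin n₀ : X.LC) = f.lin.baseChange ℂ ((1 : ℂ) ⊗ₜ n₀) :=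
    (LinearMap.baseChange_tmul _ _ _).symm
  rw [h1, typOp_baseChange_apply, ← lamC_comp_apply]
  exact hN U n₀ hn₀ (lam ∘ₗ f.lin) fun m hm => hlam (f.lin m) (Submodule.mem_map_of_mem hm)

/-- **kernels**: the kernel of a Hodge map is a sub-Hodge structure -/
theorem isSubHS_ker (g : Hom Z X) : X.IsSubHS (LinearMap.ker g.lin) := by
  intro U n hn lam hlam
  -- `lam` vanishes on `ker g`, so it factors through `g`
  have hmem : lam ∈ (LinearMap.ker g.lin).dualAnnihilator := (Submodule.mem_dualAnnihilator lam).mpr hlam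
  rw [← LinearMap.range_dualMap_eq_dualAnnihilator_ker] at hmem
  obtain ⟨mu, hmu⟩ := LinearMap.mem_range.mp hmem
  have hmu' : lam = mu ∘ₗ g.lin := by rw [← hmu]; rfl
  rw [hmu', lamC_comp_apply, ← typOp_baseChange_apply, LinearMap.baseChange_tmul,
    LinearMap.mem_ker.mp hn, TensorProduct.tmul_zero, map_zero, map_zero]

/-- **intersections** -/
theorem IsSubHS.inf {N M : Submodule ℚ X.L} (hN : X.IsSubHS N) (hM : X.IsSubHS M) : X.IsSubHS (N ⊓ M) := by
  intro U n hn lam hlam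
  have hmem : lam ∈ (N ⊓ M).dualAnnihilator := (Submodule.mem_dualAnnihilator lam).mpr hlam
  rw [Subspace.dualAnnihilator_inf_eq] at hmem
  obtain ⟨l₁, hl₁, l₂, hl₂, rfl⟩ := Submodule.mem_sup.mp hmem
  rw [lamC_add, LinearMap.add_apply,
    hN U n (Submodule.mem_inf.mp hn).1 l₁ ((Submodule.mem_dualAnnihilator l₁).mp hl₁),
    hM U n (Submodule.mem_inf.mp hn).2 l₂ ((Submodule.mem_dualAnnihilator l₂).mp hl₂), add_zero]

/-- **sums** -/
theorem IsSubHS.sup {N M : Submodule ℚ X.L} (hN : X.IsSubHS N) (hM : X.IsSubHS M) : X.IsSubHS (N ⊔ M) := by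
  intro U n hn lam hlam
  obtain ⟨n₁, hn₁, n₂, hn₂, rfl⟩ := Submodule.mem_sup.mp hn
  rw [TensorProduct.tmul_add, map_add, map_add,
    hN U n₁ hn₁ lam (fun m hm => hlam m (Submodule.mem_sup_left hm)),
    hM U n₂ hn₂ lam (fun m hm => hlam m (Submodule.mem_sup_right hm)), add_zero]

/-- finite suprema -/
theorem isSubHS_biSup {ι : Type*} (T : Finset ι) (N : ι → Submodule ℚ X.L) (h : ∀ i ∈ T, X.IsSubHS (N i)) :
    X.IsSubHS (⨆ i ∈ T, N i) := by
  classical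
  induction T using Finset.induction_on with
  | empty => simpa using X.isSubHS_bot
  | insert a T ha ih =>
      rw [Finset.iSup_insert]
      exact (h a (Finset.mem_insert_self a T)).sup (ih fun i hi => h i (Finset.mem_insert_of_mem hi))

/-- the range of a Hodge map is a sub-Hodge structure -/
theorem isSubHS_range (f : Hom X Y) : X.IsSubHS (LinearMap.range f.lin) := by
  rw [← Submodule.map_top]
  exact (Y.isSubHS_top).map f

/-! ### Rigidity of one-atom CM objects with pairwise distinct Galois types -/

/-- with `U` the indicator of `typ s₀` and the types pairwise distinct, `D_U` is the coordinate projector `E_{s₀}` -/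
lemma typOp_indicator_one_tmul (hinj : Function.Injective X.typ) (s₀ : X.Idx) (ℓ : X.L) :
    X.typOp (fun T => if T = X.typ s₀ then 1 else 0) ((1 : ℂ) ⊗ₜ ℓ) = s₀.2 (ℓ s₀.1) • X.eB s₀ := by
  classical
  refine X.eB.repr.injective (Finsupp.ext fun s => ?_)
  rw [repr_typOp, repr_one_tmul, map_smul, Basis.repr_self, Finsupp.smul_apply, Finsupp.single_apply,
    smul_eq_mul]
  by_cases h : s = s₀
  · subst h; simp
  · have h' : X.typ s ≠ X.typ s₀ := fun e => h (hinj e)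
    rw [if_neg h', zero_mul, if_neg (Ne.symm h), mul_zero]

/-- **rigidity**: a one-atom object with pairwise distinct Galois types has no sub-Hodge structures but `⊥`, `⊤` -/
theorem IsSubHS.eq_bot_or_eq_top {K : CMField} {Φ : CMType K}
    (hinj : Function.Injective (cmObj K Φ).typ) {N : Submodule ℚ (cmObj K Φ).L}
    (hN : (cmObj K Φ).IsSubHS N) : N = ⊥ ∨ N = ⊤ := by
  classical
  by_cases htop : N = ⊤
  · exact Or.inr htop
  left
  obtain ⟨lam, hlam0, hlamN⟩ :=
    Submodule.exists_dual_map_eq_bot_of_lt_top (lt_top_iff_ne_top.mpr htop) inferInstance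
  have hlamN' : ∀ m ∈ N, lam m = 0 := fun m hm =>
    (Submodule.mem_bot ℚ).mp (hlamN ▸ Submodule.mem_map_of_mem hm)
  -- every `n ∈ N` is zero: otherwise `λ_ℂ(e_s) = 0` for all `s`, i.e. `λ = 0`
  refine (Submodule.eq_bot_iff N).mpr fun n hn => ?_
  by_contra hne
  have hcoord : ∀ s : (cmObj K Φ).Idx, (cmObj K Φ).lamC lam ((cmObj K Φ).eB s) = 0 := by
    intro s
    have h := hN (fun T => if T = (cmObj K Φ).typ s then 1 else 0) n hn lam hlamN'
    rw [typOp_indicator_one_tmul hinj, map_smul, smul_eq_zero] at h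
    rcases h with h | h
    · -- `s.2 (n s.1) = 0` forces `n = 0` (one atom, embeddings are injective)
      exfalso
      apply hne
      funext i
      have hi : i = s.1 := Subsingleton.elim _ _
      subst hi
      exact (map_eq_zero_iff _ (RingHom.injective _)).mp h
    · exact h
  apply hlam0
  refine (cmObj K Φ).lam_eq_zero_of_lamC lam fun ℓ => ?_
  rw [one_tmul_eq_sum, map_sum]
  exact Finset.sum_eq_zero fun s _ => by rw [map_smul, hcoord, smul_zero]

/-- **primitive CM types have pairwise distinct Galois types** (for `K` Galois): if two eigen-indices `s, t` of
`A_{(K,Φ)}` have the same Galois type then `σ_t = σ_s ∘ g` with `g` in the right stabiliser of `Φ`, so `g = 1`. -/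
theorem typ_injective_of_primitive {K : CMField} [IsGalois ℚ K] {Φ : CMType K} (h : Primitive K Φ) :
    Function.Injective (cmObj K Φ).typ := by
  intro s t hst
  -- the two embeddings `K → ℚ̄`
  let σs : K →+* Qbar := embQ Φ s
  let σt : K →+* Qbar := embQ Φ t
  letI : Algebra K Qbar := σs.toAlgebra
  have hσ : ∀ y : K, algebraMap K Qbar y = σs y := fun _ => rfl
  -- `σt = σs ∘ g` for an automorphism `g` of `K` (normality of `K/ℚ`)
  let g : K ≃ₐ[ℚ] K := (σt.toRatAlgHom).restrictNormal' K
  have hg : ∀ y : K, σs (g y) = σt y := fun y => AlgHom.restrictNormal_commutes (σt.toRatAlgHom) K y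
  -- restriction of automorphisms of `ℚ̄` to `K` along `σs`
  let r : Gam →* (K ≃ₐ[ℚ] K) := AlgEquiv.restrictNormalHom K
  have hr : ∀ (γ : Gam) (y : K), σs (r γ y) = γ (σs y) := fun γ y => by
    rw [← hσ, ← hσ]
    exact AlgEquiv.restrictNormal_commutes γ K y
  have hsurj : Function.Surjective r := AlgEquiv.restrictNormalHom_surjective (F := ℚ) (K₁ := K) (E := Qbar)
  set φ₀ : K →+* ℂ := (algebraMap Qbar ℂ).comp σs with hφ₀
  have keyS : ∀ γ : Gam, γ ∈ typQ Φ σs ↔ φ₀.comp ((r γ : K ≃ₐ[ℚ] K) : K →+* K) ∈ Φ.1 := fun γ => by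
    have hγ : (algebraMap Qbar ℂ).comp (γ.toRingEquiv.toRingHom.comp σs)
        = φ₀.comp ((r γ : K ≃ₐ[ℚ] K) : K →+* K) := by
      refine RingHom.ext fun y => ?_
      show ((γ (σs y) : Qbar) : ℂ) = ((σs (r γ y) : Qbar) : ℂ)
      rw [hr]
    rw [mem_typQ, hγ]
  have keyT : ∀ γ : Gam, γ ∈ typQ Φ σt ↔ φ₀.comp ((r γ * g : K ≃ₐ[ℚ] K) : K →+* K) ∈ Φ.1 := fun γ => by
    have hγ : (algebraMap Qbar ℂ).comp (γ.toRingEquiv.toRingHom.comp σt)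
        = φ₀.comp ((r γ * g : K ≃ₐ[ℚ] K) : K →+* K) := by
      refine RingHom.ext fun y => ?_
      show ((γ (σt y) : Qbar) : ℂ) = ((σs ((r γ * g) y) : Qbar) : ℂ)
      rw [AlgEquiv.mul_apply, hr, hg]
    rw [mem_typQ, hγ]
  -- equal types ⇒ `g` stabilises `Φ` on the right ⇒ `g = 1`
  have hg1 : g = 1 := by
    refine h φ₀ g fun g' => ?_
    obtain ⟨γ, rfl⟩ := hsurj g'
    rw [← keyT, ← keyS, ← mem_typ_cmObj_iff, ← mem_typ_cmObj_iff, hst]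
  have hστ : σs = σt := by
    refine RingHom.ext fun y => ?_
    rw [← hg, hg1, AlgEquiv.one_apply]
  -- the index is determined by its embedding
  obtain ⟨i, τ⟩ := s
  obtain ⟨j, τ'⟩ := t
  obtain rfl : i = j := Subsingleton.elim _ _
  have hτ : τ = τ' := by
    refine RingHom.ext fun x => ?_
    obtain ⟨y, rfl⟩ := (eK K).surjective x
    have h1 : ((σs y : Qbar) : ℂ) = ((σt y : Qbar) : ℂ) := by rw [hστ]
    have h2 : (((cmObj K Φ).liftE ⟨i, τ⟩ (eK K y) : Qbar) : ℂ) = (((cmObj K Φ).liftE ⟨i, τ'⟩ (eK K y) : Qbar) : ℂ) :=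
      h1
    rwa [coe_liftE, coe_liftE] at h2
  rw [hτ]

end Obj

end HodgeCM.Toy

end
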